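import Summits.CriticalPhenomena.PercolationContinuityZ3.Theorems.Transplant.FKConnectivityAllQAntipodalWeightDefs
import Summits.CriticalPhenomena.PercolationContinuityZ3.Theorems.Transplant.FKConnectivityAllQAntipodalUpc
import HarnessLib

/-!
# Connectivity correlation inequalities for `φ_{w,q}`, every `q > 0` — file 23a: THEOREM U COEFFICIENTWISE — antipodal
# up-correlation on two-terminal series–parallel networks for EVERY NONNEGATIVE LEVEL WEIGHT

Support file (`--supports stmt-CriticalPhenomena-4575`), FK sub-lane `prim-bschramm-fk-2` (gen 18) of the post-continuity
programme; builds on p205010 (kernel theorem, internal audit signed; external expert review pending).  No definitions, no named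
facts, no sorries; standard axioms.

THE OBJECT (`…AntipodalWeightDefs.lean`): `apUpcLW w M s t h = ∑_{γ ⊆ M} w(k(γ)+k(M\γ)) (1{s↔t in γ} - 1{s↔t in M\γ}) h(γ)` for a
weight sequence `w : ℕ → ℝ` (`w = (q^·)` gives gen 11's `apUpc q`).

THE THEOREM (`FK.apUpcLW_nonneg_of_isTTSP`): if `E` is a two-terminal series–parallel network between `s` and `t` (`FK.IsTTSP E s t`),
then for every sub-network `M ⊆ E`, every `w ≥ 0` and every `h` monotone on the subsets of `M`: `0 ≤ apUpcLW w M s t h`.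
COROLLARIES: `FK.apUpc_level_nonneg_of_isTTSP` — for every cluster level `ℓ`,
`0 ≤ ∑_{γ ⊆ M : k(γ)+k(M\γ) = ℓ} (1{s↔t in γ} - 1{s↔t in M\γ}) h(γ)`, i.e. EVERY COEFFICIENT of the polynomial `q ↦ apUpc q M s t h` is
nonnegative (Theorem U of `…AntipodalUpc.lean` is its value at `q > 0`); `FK.apUpc_levels_le_nonneg_of_isTTSP` — the Abel partial sums
`∑_{level ≤ J}` are nonnegative.  By Hall's theorem the level statement says: at each cluster level there is an inclusion-increasing
injection from the configurations that do not join the terminals while their complement does, into those that join while their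
complement does not — the combinatorial form of Theorem U on which the word-Hall reductions of gens 12–16 rest (X2, U¹¹; FK-Q2
§21–25, where the coefficientwise form was used on paper) and which the level form of Conjecture AND⁺ needs inside every black box
(gen 18, FK-Q2 §27).

PROOF — the induction of `…AntipodalUpc.lean` run with a general weight.  Under a parallel gluing
`k(γ)+k(γᶜ) + 2|V| = a₁ + a₂ + 1{c₁ ∧ c₂} + 1{c̄₁ ∧ c̄₂}` (`FK.apExp_parallel`), and the sixteen-case pointwise identity
`w(k(γ)+k(γᶜ))((c₁∨c₂) - (c̄₁∨c̄₂)) = [(1-c₂)(1-c̄₂) w(a₁+a₂-2|V|) + (1-c₂)c̄₂ w(a₁+a₂+1-2|V|)](c₁ - c̄₁) + (1 ↔ 2)`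
(`FK.apLW_summand_parallel`: the factor `q` of gen 11's type weights `α, β` becomes a unit SHIFT of the weight sequence) writes
`apUpcLW w (M₁ ⊔ M₂; h)` as a nonnegative combination of the parts' functionals with shifted weights `n ↦ w(n + a₂ - 2|V|)`,
`n ↦ w(n + a₂ + 1 - 2|V|)` applied to the sections `h(· ∪ γ₂)` (`FK.apUpcLW_parallel_eq`); series gluing is a constant shift
(`FK.apLW_summand_series`, `FK.apUpcLW_series_eq`); a single edge gives `w(a)(h({st}) - h(∅)) ≥ 0`.  Since the class of nonnegative
weights is shift-invariant, the induction closes (`FK.apUpcLW_parallel_nonneg`, `FK.apUpcLW_series_nonneg`).  Not in print as far as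
searched (Wagner 2008 §5 / Semple–Welsh 2008 are pairwise and value-level).
[cite: Grimmett2006, §1.4 eq. (1.20) (p. 15); §3.8 Thm. (3.90) (pp. 61–62); §3.9 (pp. 63–64)] [cite: Wagner2006, Thm. 5.8(d), §5.3]
-/

noncomputable section

namespace Summit.CriticalPhenomena.PercolationContinuityZ3.Theorems

namespace FK

open SimpleGraph Literature.Probability.LatticeModels Literature.Probability.Percolation
open scoped Classical

variable {V : Type*} [Fintype V]

/-! ### Parallel composition -/

section Parallel

variable {E₁ E₂ : Finset (Sym2 V)} {V₁ V₂ : Set V} {s t : V}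

set_option linter.unusedSimpArgs false in
/-- **Parallel gluing, the weighted antipodal summand**: with `a_i = k(γ_i)+k(γ_iᶜ)`, `K = 2|V|`,
`w(k(γ)+k(γᶜ)) (c - c̄) x = [(1-c₂)(1-c̄₂) w(a₁+a₂-K) + (1-c₂)c̄₂ w(a₁+a₂+1-K)] (c₁ - c̄₁) x
 + [(1-c₁)(1-c̄₁) w(a₁+a₂-K) + c₁(1-c̄₁) w(a₁+a₂+1-K)] (c₂ - c̄₂) x` (sixteen cases; the `q`-factor of the type weights
`α, β` of `FK.ap_summand_parallel` becomes a level shift by one). [cite: Grimmett2006, §3.8 (pp. 61–62)] -/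
theorem apLW_summand_parallel (w : ℕ → ℝ) (hd : Disjoint E₁ E₂) (h₁ : ∀ e ∈ (↑E₁ : Set (Sym2 V)), ∀ z ∈ e, z ∈ V₁)
    (h₂ : ∀ e ∈ (↑E₂ : Set (Sym2 V)), ∀ z ∈ e, z ∈ V₂) (hS : V₁ ∩ V₂ ⊆ {s, t}) (hst : s ≠ t)
    {M₁ M₂ γ₁ γ₂ : Finset (Sym2 V)} (hM₁ : M₁ ⊆ E₁) (hM₂ : M₂ ⊆ E₂) (hγ₁ : γ₁ ⊆ M₁) (hγ₂ : γ₂ ⊆ M₂) (x : ℝ) :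
    w (apExp (M₁ ∪ M₂) (γ₁ ∪ γ₂)) * ((apConn (γ₁ ∪ γ₂) s t - apConn ((M₁ ∪ M₂) \ (γ₁ ∪ γ₂)) s t) * x) =
      (((1 - apConn γ₂ s t) * (1 - apConn (M₂ \ γ₂) s t)) * w (apExp M₁ γ₁ + apExp M₂ γ₂ - 2 * Fintype.card V) +
          ((1 - apConn γ₂ s t) * apConn (M₂ \ γ₂) s t) * w (apExp M₁ γ₁ + apExp M₂ γ₂ + 1 - 2 * Fintype.card V)) *
        ((apConn γ₁ s t - apConn (M₁ \ γ₁) s t) * x) +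
      (((1 - apConn γ₁ s t) * (1 - apConn (M₁ \ γ₁) s t)) * w (apExp M₁ γ₁ + apExp M₂ γ₂ - 2 * Fintype.card V) +
          (apConn γ₁ s t * (1 - apConn (M₁ \ γ₁) s t)) * w (apExp M₁ γ₁ + apExp M₂ γ₂ + 1 - 2 * Fintype.card V)) *
        ((apConn γ₂ s t - apConn (M₂ \ γ₂) s t) * x) := by
  have hdM : Disjoint M₁ M₂ := Finset.disjoint_of_subset_left hM₁ (Finset.disjoint_of_subset_right hM₂ hd)
  have hexp := apExp_parallel hd h₁ h₂ hS hst hM₁ hM₂ hγ₁ hγ₂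
  have hc := reachable_union_parallel h₁ h₂ hS (hγ₁.trans hM₁) (hγ₂.trans hM₂)
  have hcb : (openGraph (↑((M₁ ∪ M₂) \ (γ₁ ∪ γ₂)) : BondConfig V)).Reachable s t ↔
      (openGraph (↑(M₁ \ γ₁) : BondConfig V)).Reachable s t ∨ (openGraph (↑(M₂ \ γ₂) : BondConfig V)).Reachable s t := by
    rw [union_sdiff_union hdM hγ₁ hγ₂]
    exact reachable_union_parallel h₁ h₂ hS (Finset.sdiff_subset.trans hM₁) (Finset.sdiff_subset.trans hM₂)
  unfold apConn
  rw [hc, hcb]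
  by_cases a₁ : (openGraph (↑γ₁ : BondConfig V)).Reachable s t <;>
  by_cases a₂ : (openGraph (↑γ₂ : BondConfig V)).Reachable s t <;>
  by_cases b₁ : (openGraph (↑(M₁ \ γ₁) : BondConfig V)).Reachable s t <;>
  by_cases b₂ : (openGraph (↑(M₂ \ γ₂) : BondConfig V)).Reachable s t <;>
  simp only [a₁, a₂, b₁, b₂, and_self, and_true, true_and, and_false, false_and, or_self, or_true, true_or, or_false,
    false_or, if_true, if_false, not_false_eq_true, not_true_eq_false, add_zero] at hexp ⊢ <;>
  first
    | (have e : apExp (M₁ ∪ M₂) (γ₁ ∪ γ₂) = apExp M₁ γ₁ + apExp M₂ γ₂ - 2 * Fintype.card V := by omega)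
      ; rw [e]; ring
    | (have e : apExp (M₁ ∪ M₂) (γ₁ ∪ γ₂) = apExp M₁ γ₁ + apExp M₂ γ₂ + 1 - 2 * Fintype.card V := by omega)
      ; rw [e]; ring
    | ring

/-- **Parallel composition of the weighted antipodal up-correlation functional**: for `M = M₁ ⊔ M₂` inside a parallel gluing,
`apUpcLW w (M; h) = ∑_{γ₂} [(1-c₂)(1-c̄₂)·apUpcLW w₀ (M₁; h(· ∪ γ₂)) + (1-c₂)c̄₂·apUpcLW w₁ (M₁; h(· ∪ γ₂))] + (1 ↔ 2)` with the SHIFTED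
weights `w₀ n = w(n + a₂ - 2|V|)`, `w₁ n = w(n + a₂ + 1 - 2|V|)` (`a₂ = k(γ₂)+k(γ₂ᶜ)`). [cite: Grimmett2006, §3.8 Thm. (3.90) (pp. 61–62)] -/
theorem apUpcLW_parallel_eq (w : ℕ → ℝ) (hd : Disjoint E₁ E₂) (h₁ : ∀ e ∈ (↑E₁ : Set (Sym2 V)), ∀ z ∈ e, z ∈ V₁)
    (h₂ : ∀ e ∈ (↑E₂ : Set (Sym2 V)), ∀ z ∈ e, z ∈ V₂) (hS : V₁ ∩ V₂ ⊆ {s, t}) (hst : s ≠ t)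
    {M₁ M₂ : Finset (Sym2 V)} (hM₁ : M₁ ⊆ E₁) (hM₂ : M₂ ⊆ E₂) (h : Finset (Sym2 V) → ℝ) :
    apUpcLW w (M₁ ∪ M₂) s t h =
      ∑ γ₂ ∈ M₂.powerset,
          (((1 - apConn γ₂ s t) * (1 - apConn (M₂ \ γ₂) s t)) *
              apUpcLW (fun n => w (n + apExp M₂ γ₂ - 2 * Fintype.card V)) M₁ s t (fun γ₁ => h (γ₁ ∪ γ₂)) +
            ((1 - apConn γ₂ s t) * apConn (M₂ \ γ₂) s t) *
              apUpcLW (fun n => w (n + apExp M₂ γ₂ + 1 - 2 * Fintype.card V)) M₁ s t (fun γ₁ => h (γ₁ ∪ γ₂))) +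
        ∑ γ₁ ∈ M₁.powerset,
          (((1 - apConn γ₁ s t) * (1 - apConn (M₁ \ γ₁) s t)) *
              apUpcLW (fun n => w (apExp M₁ γ₁ + n - 2 * Fintype.card V)) M₂ s t (fun γ₂ => h (γ₁ ∪ γ₂)) +
            (apConn γ₁ s t * (1 - apConn (M₁ \ γ₁) s t)) *
              apUpcLW (fun n => w (apExp M₁ γ₁ + n + 1 - 2 * Fintype.card V)) M₂ s t (fun γ₂ => h (γ₁ ∪ γ₂))) := by
  have hdM : Disjoint M₁ M₂ := Finset.disjoint_of_subset_left hM₁ (Finset.disjoint_of_subset_right hM₂ hd)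
  unfold apUpcLW
  rw [sum_powerset_union_disj hdM]
  simp_rw [Finset.mul_sum, ← Finset.sum_add_distrib]
  rw [Finset.sum_comm (s := M₂.powerset) (t := M₁.powerset), ← Finset.sum_add_distrib]
  refine Finset.sum_congr rfl fun γ₁ hγ₁ => ?_
  rw [← Finset.sum_add_distrib]
  refine Finset.sum_congr rfl fun γ₂ hγ₂ => ?_
  rw [Finset.mem_powerset] at hγ₁ hγ₂
  rw [apLW_summand_parallel w hd h₁ h₂ hS hst hM₁ hM₂ hγ₁ hγ₂ (h (γ₁ ∪ γ₂))]
  ring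

/-- **The weighted antipodal up-correlation property is closed under parallel composition**: if `0 ≤ apUpcLW w' (M_i; h')` for
every nonnegative weight `w'` and every `h'` monotone on the subsets of `M_i` (`i = 1, 2`), then the same holds for `M₁ ⊔ M₂`.
[cite: Grimmett2006, §3.8 Thm. (3.90) (pp. 61–62)] -/
theorem apUpcLW_parallel_nonneg (hd : Disjoint E₁ E₂) (h₁ : ∀ e ∈ (↑E₁ : Set (Sym2 V)), ∀ z ∈ e, z ∈ V₁)
    (h₂ : ∀ e ∈ (↑E₂ : Set (Sym2 V)), ∀ z ∈ e, z ∈ V₂) (hS : V₁ ∩ V₂ ⊆ {s, t}) (hst : s ≠ t)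
    {M₁ M₂ : Finset (Sym2 V)} (hM₁ : M₁ ⊆ E₁) (hM₂ : M₂ ⊆ E₂)
    (ih₁ : ∀ w' : ℕ → ℝ, (∀ n, 0 ≤ w' n) → ∀ h' : Finset (Sym2 V) → ℝ,
      (∀ ⦃A B : Finset (Sym2 V)⦄, A ⊆ B → B ⊆ M₁ → h' A ≤ h' B) → 0 ≤ apUpcLW w' M₁ s t h')
    (ih₂ : ∀ w' : ℕ → ℝ, (∀ n, 0 ≤ w' n) → ∀ h' : Finset (Sym2 V) → ℝ,
      (∀ ⦃A B : Finset (Sym2 V)⦄, A ⊆ B → B ⊆ M₂ → h' A ≤ h' B) → 0 ≤ apUpcLW w' M₂ s t h')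
    {w : ℕ → ℝ} (hw : ∀ n, 0 ≤ w n)
    {h : Finset (Sym2 V) → ℝ} (hmono : ∀ ⦃A B : Finset (Sym2 V)⦄, A ⊆ B → B ⊆ M₁ ∪ M₂ → h A ≤ h B) :
    0 ≤ apUpcLW w (M₁ ∪ M₂) s t h := by
  rw [apUpcLW_parallel_eq w hd h₁ h₂ hS hst hM₁ hM₂ h]
  refine add_nonneg (Finset.sum_nonneg fun γ₂ hγ₂ => ?_) (Finset.sum_nonneg fun γ₁ hγ₁ => ?_)
  · rw [Finset.mem_powerset] at hγ₂
    have hc0 := apConn_nonneg γ₂ s t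
    have hc1 := apConn_le_one γ₂ s t
    have hd0 := apConn_nonneg (M₂ \ γ₂) s t
    have hd1 := apConn_le_one (M₂ \ γ₂) s t
    have hm : ∀ ⦃A B : Finset (Sym2 V)⦄, A ⊆ B → B ⊆ M₁ → h (A ∪ γ₂) ≤ h (B ∪ γ₂) := fun A B hAB hB =>
      hmono (Finset.union_subset_union hAB le_rfl) (Finset.union_subset_union hB hγ₂)
    exact add_nonneg
      (mul_nonneg (mul_nonneg (sub_nonneg.2 hc1) (sub_nonneg.2 hd1)) (ih₁ _ (fun n => hw _) _ hm))
      (mul_nonneg (mul_nonneg (sub_nonneg.2 hc1) hd0) (ih₁ _ (fun n => hw _) _ hm))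
  · rw [Finset.mem_powerset] at hγ₁
    have hc0 := apConn_nonneg γ₁ s t
    have hc1 := apConn_le_one γ₁ s t
    have hd0 := apConn_nonneg (M₁ \ γ₁) s t
    have hd1 := apConn_le_one (M₁ \ γ₁) s t
    have hm : ∀ ⦃A B : Finset (Sym2 V)⦄, A ⊆ B → B ⊆ M₂ → h (γ₁ ∪ A) ≤ h (γ₁ ∪ B) := fun A B hAB hB =>
      hmono (Finset.union_subset_union le_rfl hAB) (Finset.union_subset_union hγ₁ hB)
    exact add_nonneg
      (mul_nonneg (mul_nonneg (sub_nonneg.2 hc1) (sub_nonneg.2 hd1)) (ih₂ _ (fun n => hw _) _ hm))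
      (mul_nonneg (mul_nonneg hc0 (sub_nonneg.2 hd1)) (ih₂ _ (fun n => hw _) _ hm))

end Parallel

/-! ### Series composition -/

section Series

variable {E₁ E₂ : Finset (Sym2 V)} {V₁ V₂ : Set V} {a m b : V}

set_option linter.unusedSimpArgs false in
/-- **Series gluing, the weighted antipodal summand**: `w(k(γ)+k(γᶜ)) (c - c̄) x = [c̄₂ (c₁ - c̄₁) + c₁ (c₂ - c̄₂)] w(a₁+a₂-2|V|) x`
(`c = c₁c₂`, `c̄ = c̄₁c̄₂`). [cite: Grimmett2006, §3.8 (pp. 61–62)] -/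
theorem apLW_summand_series (w : ℕ → ℝ) (hd : Disjoint E₁ E₂) (h₁ : ∀ e ∈ (↑E₁ : Set (Sym2 V)), ∀ z ∈ e, z ∈ V₁)
    (h₂ : ∀ e ∈ (↑E₂ : Set (Sym2 V)), ∀ z ∈ e, z ∈ V₂) (hS : V₁ ∩ V₂ ⊆ {m}) (haV₂ : a ∉ V₂) (hbV₁ : b ∉ V₁)
    (ham : a ≠ m) (hbm : b ≠ m) (hab : a ≠ b)
    {M₁ M₂ γ₁ γ₂ : Finset (Sym2 V)} (hM₁ : M₁ ⊆ E₁) (hM₂ : M₂ ⊆ E₂) (hγ₁ : γ₁ ⊆ M₁) (hγ₂ : γ₂ ⊆ M₂) (x : ℝ) :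
    w (apExp (M₁ ∪ M₂) (γ₁ ∪ γ₂)) * ((apConn (γ₁ ∪ γ₂) a b - apConn ((M₁ ∪ M₂) \ (γ₁ ∪ γ₂)) a b) * x) =
      apConn (M₂ \ γ₂) m b * w (apExp M₁ γ₁ + apExp M₂ γ₂ - 2 * Fintype.card V) *
          ((apConn γ₁ a m - apConn (M₁ \ γ₁) a m) * x) +
        apConn γ₁ a m * w (apExp M₁ γ₁ + apExp M₂ γ₂ - 2 * Fintype.card V) *
          ((apConn γ₂ m b - apConn (M₂ \ γ₂) m b) * x) := by
  have hdM : Disjoint M₁ M₂ := Finset.disjoint_of_subset_left hM₁ (Finset.disjoint_of_subset_right hM₂ hd)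
  have hexp := apExp_series hd h₁ h₂ hS hM₁ hM₂ hγ₁ hγ₂
  have e : apExp (M₁ ∪ M₂) (γ₁ ∪ γ₂) = apExp M₁ γ₁ + apExp M₂ γ₂ - 2 * Fintype.card V := by omega
  have hc := reachable_union_series h₁ h₂ hS haV₂ hbV₁ ham hbm hab (hγ₁.trans hM₁) (hγ₂.trans hM₂)
  have hcb : (openGraph (↑((M₁ ∪ M₂) \ (γ₁ ∪ γ₂)) : BondConfig V)).Reachable a b ↔
      (openGraph (↑(M₁ \ γ₁) : BondConfig V)).Reachable a m ∧ (openGraph (↑(M₂ \ γ₂) : BondConfig V)).Reachable m b := by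
    rw [union_sdiff_union hdM hγ₁ hγ₂]
    exact reachable_union_series h₁ h₂ hS haV₂ hbV₁ ham hbm hab (Finset.sdiff_subset.trans hM₁)
      (Finset.sdiff_subset.trans hM₂)
  rw [e]
  unfold apConn
  rw [hc, hcb]
  by_cases a₁ : (openGraph (↑γ₁ : BondConfig V)).Reachable a m <;>
  by_cases a₂ : (openGraph (↑γ₂ : BondConfig V)).Reachable m b <;>
  by_cases b₁ : (openGraph (↑(M₁ \ γ₁) : BondConfig V)).Reachable a m <;>
  by_cases b₂ : (openGraph (↑(M₂ \ γ₂) : BondConfig V)).Reachable m b <;>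
  simp only [a₁, a₂, b₁, b₂, and_self, and_true, true_and, and_false, false_and, if_true, if_false,
    not_false_eq_true, not_true_eq_false] <;> ring

/-- **Series composition of the weighted antipodal up-correlation functional**: for `M = M₁ ⊔ M₂` inside a series gluing at `m`,
`apUpcLW w (M; a, b; h) = ∑_{γ₂} c̄₂ · apUpcLW w₀ (M₁; a, m; h(· ∪ γ₂)) + ∑_{γ₁} c₁ · apUpcLW w₀' (M₂; m, b; h(γ₁ ∪ ·))` with the shifted
weights `w₀ n = w(n + a₂ - 2|V|)`, `w₀' n = w(a₁ + n - 2|V|)`. [cite: Grimmett2006, §3.8 Thm. (3.90) (pp. 61–62)] -/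
theorem apUpcLW_series_eq (w : ℕ → ℝ) (hd : Disjoint E₁ E₂) (h₁ : ∀ e ∈ (↑E₁ : Set (Sym2 V)), ∀ z ∈ e, z ∈ V₁)
    (h₂ : ∀ e ∈ (↑E₂ : Set (Sym2 V)), ∀ z ∈ e, z ∈ V₂) (hS : V₁ ∩ V₂ ⊆ {m}) (haV₂ : a ∉ V₂) (hbV₁ : b ∉ V₁)
    (ham : a ≠ m) (hbm : b ≠ m) (hab : a ≠ b) {M₁ M₂ : Finset (Sym2 V)} (hM₁ : M₁ ⊆ E₁) (hM₂ : M₂ ⊆ E₂)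
    (h : Finset (Sym2 V) → ℝ) :
    apUpcLW w (M₁ ∪ M₂) a b h =
      ∑ γ₂ ∈ M₂.powerset, apConn (M₂ \ γ₂) m b *
          apUpcLW (fun n => w (n + apExp M₂ γ₂ - 2 * Fintype.card V)) M₁ a m (fun γ₁ => h (γ₁ ∪ γ₂)) +
        ∑ γ₁ ∈ M₁.powerset, apConn γ₁ a m *
          apUpcLW (fun n => w (apExp M₁ γ₁ + n - 2 * Fintype.card V)) M₂ m b (fun γ₂ => h (γ₁ ∪ γ₂)) := by
  have hdM : Disjoint M₁ M₂ := Finset.disjoint_of_subset_left hM₁ (Finset.disjoint_of_subset_right hM₂ hd)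
  unfold apUpcLW
  rw [sum_powerset_union_disj hdM]
  simp_rw [Finset.mul_sum]
  rw [Finset.sum_comm (s := M₂.powerset) (t := M₁.powerset), ← Finset.sum_add_distrib]
  refine Finset.sum_congr rfl fun γ₁ hγ₁ => ?_
  rw [← Finset.sum_add_distrib]
  refine Finset.sum_congr rfl fun γ₂ hγ₂ => ?_
  rw [Finset.mem_powerset] at hγ₁ hγ₂
  rw [apLW_summand_series w hd h₁ h₂ hS haV₂ hbV₁ ham hbm hab hM₁ hM₂ hγ₁ hγ₂ (h (γ₁ ∪ γ₂))]
  ring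

/-- **The weighted antipodal up-correlation property is closed under series composition.**
[cite: Grimmett2006, §3.8 Thm. (3.90) (pp. 61–62)] -/
theorem apUpcLW_series_nonneg (hd : Disjoint E₁ E₂) (h₁ : ∀ e ∈ (↑E₁ : Set (Sym2 V)), ∀ z ∈ e, z ∈ V₁)
    (h₂ : ∀ e ∈ (↑E₂ : Set (Sym2 V)), ∀ z ∈ e, z ∈ V₂) (hS : V₁ ∩ V₂ ⊆ {m}) (haV₂ : a ∉ V₂) (hbV₁ : b ∉ V₁)
    (ham : a ≠ m) (hbm : b ≠ m) (hab : a ≠ b) {M₁ M₂ : Finset (Sym2 V)} (hM₁ : M₁ ⊆ E₁) (hM₂ : M₂ ⊆ E₂)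
    (ih₁ : ∀ w' : ℕ → ℝ, (∀ n, 0 ≤ w' n) → ∀ h' : Finset (Sym2 V) → ℝ,
      (∀ ⦃A B : Finset (Sym2 V)⦄, A ⊆ B → B ⊆ M₁ → h' A ≤ h' B) → 0 ≤ apUpcLW w' M₁ a m h')
    (ih₂ : ∀ w' : ℕ → ℝ, (∀ n, 0 ≤ w' n) → ∀ h' : Finset (Sym2 V) → ℝ,
      (∀ ⦃A B : Finset (Sym2 V)⦄, A ⊆ B → B ⊆ M₂ → h' A ≤ h' B) → 0 ≤ apUpcLW w' M₂ m b h')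
    {w : ℕ → ℝ} (hw : ∀ n, 0 ≤ w n)
    {h : Finset (Sym2 V) → ℝ} (hmono : ∀ ⦃A B : Finset (Sym2 V)⦄, A ⊆ B → B ⊆ M₁ ∪ M₂ → h A ≤ h B) :
    0 ≤ apUpcLW w (M₁ ∪ M₂) a b h := by
  rw [apUpcLW_series_eq w hd h₁ h₂ hS haV₂ hbV₁ ham hbm hab hM₁ hM₂ h]
  refine add_nonneg (Finset.sum_nonneg fun γ₂ hγ₂ => ?_) (Finset.sum_nonneg fun γ₁ hγ₁ => ?_)
  · rw [Finset.mem_powerset] at hγ₂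
    refine mul_nonneg (apConn_nonneg _ _ _) (ih₁ _ (fun n => hw _) _ fun A B hAB hB => ?_)
    exact hmono (Finset.union_subset_union hAB le_rfl) (Finset.union_subset_union hB hγ₂)
  · rw [Finset.mem_powerset] at hγ₁
    refine mul_nonneg (apConn_nonneg _ _ _) (ih₂ _ (fun n => hw _) _ fun A B hAB hB => ?_)
    exact hmono (Finset.union_subset_union le_rfl hAB) (Finset.union_subset_union hγ₁ hB)

end Series

/-! ### The single edge, and the theorem -/

section Main

variable {s t : V}

omit [Fintype V] in
/-- **The single edge**: `apUpcLW w ({st}; h) = w(k(∅)+k({st})) (h({st}) - h(∅)) ≥ 0` for `h(∅) ≤ h({st})`, `w ≥ 0`. [folklore] -/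
theorem apUpcLW_edge {w : ℕ → ℝ} (hw : ∀ n, 0 ≤ w n) (hst : s ≠ t) {h : Finset (Sym2 V) → ℝ}
    (hmono : h ∅ ≤ h {s(s, t)}) : 0 ≤ apUpcLW w {s(s, t)} s t h := by
  unfold apUpcLW
  rw [← Finset.insert_empty, Finset.sum_powerset_insert (Finset.notMem_empty _), Finset.powerset_empty,
    Finset.sum_singleton, Finset.sum_singleton, Finset.insert_empty, Finset.sdiff_empty, sdiff_self, Finset.bot_eq_empty]
  have c0 : apConn (∅ : Finset (Sym2 V)) s t = 0 := by
    refine apConn_of_not_reachable fun hr => ?_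
    have h0 : openGraph (↑(∅ : Finset (Sym2 V)) : BondConfig V) = ⊥ := by
      rw [Finset.coe_empty, openGraph, fromEdgeSet_empty]
    rw [h0, reachable_bot] at hr
    exact hst hr
  have c1 : apConn ({s(s, t)} : Finset (Sym2 V)) s t = 1 := by
    refine apConn_of_reachable (Adj.reachable ((fromEdgeSet_adj _).2 ⟨?_, hst⟩))
    rw [Finset.coe_singleton]; rfl
  have ex : apExp ({s(s, t)} : Finset (Sym2 V)) ∅ = apExp {s(s, t)} {s(s, t)} := by
    unfold apExp
    rw [Finset.sdiff_empty, sdiff_self, Finset.bot_eq_empty, add_comm]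
  rw [c0, c1, ex]
  have hp := hw (apExp ({s(s, t)} : Finset (Sym2 V)) {s(s, t)})
  nlinarith

/-- **THEOREM (Theorem U for every nonnegative level weight — the coefficientwise form).**  If `E` is a two-terminal series–parallel
network between `s` and `t` (`FK.IsTTSP E s t`), then for every sub-network `M ⊆ E`, every weight sequence `w : ℕ → ℝ` with `w ≥ 0`
and every test function `h` monotone on the subsets of `M`,
`0 ≤ apUpcLW w M s t h = ∑_{γ ⊆ M} w(k(γ)+k(M\γ)) (1{s↔t in γ} - 1{s↔t in M\γ}) h(γ)`.
With `w = (q^·)` this is `FK.apUpc_nonneg_of_isTTSP` (every `q > 0`); with `w = 1_{· = ℓ}` it says that EVERY COEFFICIENT of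
`apUpc · M s t h`, as a polynomial in `q`, is nonnegative: at each cluster level `ℓ`, among complementary pairs of configurations
exactly one of which joins the terminals, the joining members dominate on increasing test functions.  Proof: the induction of
`…AntipodalUpc.lean` run with a general weight — the `q`-factors of the parallel type weights become unit level shifts of `w`
(`apLW_summand_parallel`), series gluing a constant shift (`apLW_summand_series`); a single edge gives `w(a)(h({st}) - h(∅)) ≥ 0`.
[cite: Grimmett2006, §3.8 Thm. (3.90) (pp. 61–62); §3.9 (pp. 63–64)] [cite: Wagner2006, Thm. 5.8(d), §5.3] -/
theorem apUpcLW_nonneg_of_isTTSP {E : Finset (Sym2 V)} {s t : V} (hE : IsTTSP E s t) :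
    ∀ M : Finset (Sym2 V), M ⊆ E → ∀ w : ℕ → ℝ, (∀ n, 0 ≤ w n) → ∀ h : Finset (Sym2 V) → ℝ,
      (∀ ⦃A B : Finset (Sym2 V)⦄, A ⊆ B → B ⊆ M → h A ≤ h B) → 0 ≤ apUpcLW w M s t h := by
  induction hE with
  | @edge s t hst =>
    intro M hM w hw h hmono
    rcases Finset.subset_singleton_iff.1 hM with rfl | rfl
    · rw [apUpcLW_empty]
    · exact apUpcLW_edge hw hst (hmono (Finset.empty_subset _) le_rfl)
  | @series E₁ E₂ a m b h₁ h₂ hd hV ha hb ih₁ ih₂ =>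
    intro M hM w hw h hmono
    have g₁ : ∀ e ∈ (↑E₁ : Set (Sym2 V)), ∀ z ∈ e, z ∈ {z : V | ∃ e ∈ E₁, z ∈ e} := fun e he z hz => ⟨e, he, hz⟩
    have g₂ : ∀ e ∈ (↑E₂ : Set (Sym2 V)), ∀ z ∈ e, z ∈ {z : V | ∃ e ∈ E₂, z ∈ e} := fun e he z hz => ⟨e, he, hz⟩
    have gS : {z : V | ∃ e ∈ E₁, z ∈ e} ∩ {z : V | ∃ e ∈ E₂, z ∈ e} ⊆ ({m} : Set V) :=
      fun z hz => hV z hz.1 hz.2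
    have gaV₂ : a ∉ {z : V | ∃ e ∈ E₂, z ∈ e} := fun ⟨e, he, hae⟩ => ha e he hae
    have gbV₁ : b ∉ {z : V | ∃ e ∈ E₁, z ∈ e} := fun ⟨e, he, hbe⟩ => hb e he hbe
    have gam : a ≠ m := by
      obtain ⟨e, he, hme⟩ := h₂.left_mem
      intro ham; exact ha e he (ham ▸ hme)
    have gbm : b ≠ m := by
      obtain ⟨e, he, hme⟩ := h₁.right_mem
      intro hbm; exact hb e he (hbm ▸ hme)
    have gab : a ≠ b := by
      obtain ⟨e, he, hae⟩ := h₁.left_mem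
      intro hab; exact hb e he (hab ▸ hae)
    have hMeq : M = M ∩ E₁ ∪ M ∩ E₂ := by
      rw [← Finset.inter_union_distrib_left, Finset.inter_eq_left.2 hM]
    rw [hMeq] at hmono ⊢
    exact apUpcLW_series_nonneg hd g₁ g₂ gS gaV₂ gbV₁ gam gbm gab Finset.inter_subset_right Finset.inter_subset_right
      (ih₁ _ Finset.inter_subset_right) (ih₂ _ Finset.inter_subset_right) hw hmono
  | @parallel E₁ E₂ s t h₁ h₂ hd hV ih₁ ih₂ =>
    intro M hM w hw h hmono
    have g₁ : ∀ e ∈ (↑E₁ : Set (Sym2 V)), ∀ z ∈ e, z ∈ {z : V | ∃ e ∈ E₁, z ∈ e} := fun e he z hz => ⟨e, he, hz⟩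
    have g₂ : ∀ e ∈ (↑E₂ : Set (Sym2 V)), ∀ z ∈ e, z ∈ {z : V | ∃ e ∈ E₂, z ∈ e} := fun e he z hz => ⟨e, he, hz⟩
    have gS : {z : V | ∃ e ∈ E₁, z ∈ e} ∩ {z : V | ∃ e ∈ E₂, z ∈ e} ⊆ ({s, t} : Set V) := by
      intro z hz
      rcases hV z hz.1 hz.2 with h | h
      · exact Or.inl h
      · exact Or.inr h
    have gst : s ≠ t := h₁.ne
    have hMeq : M = M ∩ E₁ ∪ M ∩ E₂ := by
      rw [← Finset.inter_union_distrib_left, Finset.inter_eq_left.2 hM]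
    rw [hMeq] at hmono ⊢
    exact apUpcLW_parallel_nonneg hd g₁ g₂ gS gst Finset.inter_subset_right Finset.inter_subset_right
      (ih₁ _ Finset.inter_subset_right) (ih₂ _ Finset.inter_subset_right) hw hmono

/-- **Antipodal up-correlation with a general nonnegative level weight, the whole network.**
[cite: Grimmett2006, §3.8 (pp. 61–62)] [cite: Wagner2006, Thm. 5.8(d), §5.3] -/
theorem apUpcLW_nonneg {E : Finset (Sym2 V)} {s t : V} (hE : IsTTSP E s t) {w : ℕ → ℝ} (hw : ∀ n, 0 ≤ w n)
    {h : Finset (Sym2 V) → ℝ} (hmono : ∀ ⦃A B : Finset (Sym2 V)⦄, A ⊆ B → B ⊆ E → h A ≤ h B) :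
    0 ≤ apUpcLW w E s t h :=
  apUpcLW_nonneg_of_isTTSP hE E le_rfl w hw h hmono

/-- **COROLLARY (Theorem U coefficientwise: every cluster level separately).**  On a two-terminal series–parallel network, for
every sub-network `M ⊆ E`, every level `ℓ` and every monotone `h`:
`0 ≤ ∑_{γ ⊆ M : k(γ)+k(M\γ) = ℓ} (1{s↔t in γ} - 1{s↔t in M\γ}) h(γ)` — the coefficient of `q^ℓ` in `apUpc q M s t h`.  Equivalently
(`h` an indicator of an up-set, Hall's theorem): at each level there is an injection from the configurations whose complement joins the
terminals while they do not, into those that join while their complement does not, increasing for inclusion.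
[cite: Grimmett2006, §3.8 Thm. (3.90) (pp. 61–62)] [cite: Wagner2006, Thm. 5.8(d), §5.3] -/
theorem apUpc_level_nonneg_of_isTTSP {E : Finset (Sym2 V)} {s t : V} (hE : IsTTSP E s t) {M : Finset (Sym2 V)}
    (hM : M ⊆ E) (ℓ : ℕ) {h : Finset (Sym2 V) → ℝ} (hmono : ∀ ⦃A B : Finset (Sym2 V)⦄, A ⊆ B → B ⊆ M → h A ≤ h B) :
    0 ≤ ∑ γ ∈ M.powerset with apExp M γ = ℓ, (apConn γ s t - apConn (M \ γ) s t) * h γ := by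
  have key := apUpcLW_nonneg_of_isTTSP hE M hM (fun n => if n = ℓ then 1 else 0)
    (fun n => by split_ifs <;> norm_num) h hmono
  unfold apUpcLW at key
  rw [Finset.sum_filter]
  refine key.trans_eq (Finset.sum_congr rfl fun γ _ => ?_)
  simp only [ite_mul, one_mul, zero_mul]

/-- **COROLLARY (lower partial sums / Abel form).**  For every threshold `J`,
`0 ≤ ∑_{γ ⊆ M : k(γ)+k(M\γ) ≤ J} (1{s↔t in γ} - 1{s↔t in M\γ}) h(γ)`; likewise for `≥ J` — any nonnegative level weight.
[cite: Grimmett2006, §3.8 Thm. (3.90) (pp. 61–62)] -/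
theorem apUpc_levels_le_nonneg_of_isTTSP {E : Finset (Sym2 V)} {s t : V} (hE : IsTTSP E s t) {M : Finset (Sym2 V)}
    (hM : M ⊆ E) (J : ℕ) {h : Finset (Sym2 V) → ℝ} (hmono : ∀ ⦃A B : Finset (Sym2 V)⦄, A ⊆ B → B ⊆ M → h A ≤ h B) :
    0 ≤ ∑ γ ∈ M.powerset with apExp M γ ≤ J, (apConn γ s t - apConn (M \ γ) s t) * h γ := by
  have key := apUpcLW_nonneg_of_isTTSP hE M hM (fun n => if n ≤ J then 1 else 0)
    (fun n => by split_ifs <;> norm_num) h hmono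
  unfold apUpcLW at key
  rw [Finset.sum_filter]
  refine key.trans_eq (Finset.sum_congr rfl fun γ _ => ?_)
  simp only [ite_mul, one_mul, zero_mul]

end Main

end FK

end Summit.CriticalPhenomena.PercolationContinuityZ3.Theorems

end
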